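import Summits.FinalStateConjecture.FinalStateConjecture.Theorems.ZeroEnergyKerrOrBombHawkingExtensionIsKerrSECSectionPrep
import Literature.Geometry.Lorentzian.Hypersurface
import Mathlib.Geometry.Manifold.Instances.Sphere
import Mathlib.Geometry.Manifold.Algebra.SMul
import HarnessLib

/-!
# Crux `HawkingExtensionIsKerr` (stmt-FinalStateConjecture-17840), line `SketchIdeator2` —
# programme SEC, the section: the spacelike immersion (lead c7)

Helper file of the line lead (c7) for programme SEC, registered sub-goal `stub_sec_immersion`.
Given a finite family of K-charts `(Wᵢ, Oᵢ, χᵢ, χiᵢ)` of the DEGENERATE horizon with uniform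
`s`-room covering `C ⊆ 𝓔⁺` by sets `Vᵢ`, a `C^∞` structure on `C` in which the leaf coordinates
`fᵢ = (χᵢ · 2, χᵢ · 3)` are smooth with injective differential on `Vᵢ`, and a height `τ : C → ℝ`,
`|τ| ≤ δ/2`, with every `χᵢ · 0 + τ` smooth on `Vᵢ` (`…SECHeight`, p168849): the map
`ι c :=` the point at `K`-time `τ c` on the leaf through `c`, realised in any chart as
`χiᵢ (χᵢ c + τ c • e₀)` (chart-independent: the chart lines through `c` coincide,
`sec_lineCoincide`), is a `C^∞` SPACELIKE immersion `C → M` with image in `𝓔⁺`: in chart `i`,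
`ι = χiᵢ ∘ Zᵢ` with `Zᵢ = (χᵢ · 0 + τ) e₀ + ι₀ ∘ fᵢ` smooth into `E4`; its differential is
`dι v = ζ₀ K + ξ` with `ξ = dχiᵢ (ι₀ (dfᵢ v))` tangent to a transversal curve IN the horizon, so
`ξ ⊥ K` (`sec_orthogonal_of_horizonCurve`, HR) and `g(dι v, dι v) = g(ξ, ξ) > 0` unless
`ξ ∈ ℝ K`, which reading back through `dχᵢ` forces `dfᵢ v = 0`, `v = 0` (`sec_pos_of_transverse`).
-/

noncomputable section

set_option linter.dupNamespace false

namespace Summit.FinalStateConjecture.FinalStateConjecture.Theorems.HawkingExtensionIsKerr.SketchIdeator2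

open Set Filter Bundle Function Literature.Geometry.Lorentzian
open scoped Manifold ContDiff Topology

set_option maxHeartbeats 3200000 in
/-- **The spacelike immersion of the section (registered sub-goal `stub_sec_immersion`).**  See the
module docstring. -/
theorem stub_sec_immersion : ∀ (𝓑 : StationaryAFBlackHole.{0}) [𝓑.metric.HasLeviCivita] (U : Set 𝓑.carrier) (K : Π x : 𝓑.carrier, TangentSpace (𝓡 4) x), IsOpen U → 𝓑.horizon ⊆ U → 𝓑.metric.toPseudoRiemannianMetric.IsKillingFieldOn K U → (∀ p ∈ 𝓑.horizon, K p ≠ 0) → (∀ p ∈ 𝓑.horizon, 𝓑.metric.val p (K p) (K p) = 0) → (∀ p ∈ 𝓑.horizon, ∃ W : Set 𝓑.carrier, IsOpen W ∧ p ∈ W ∧ W ⊆ U ∧ ∃ F : 𝓑.carrier → ℝ, ContMDiffOn (𝓡 4) 𝓘(ℝ, ℝ) ∞ F W ∧ (∀ x ∈ W, x ∈ 𝓑.horizon ↔ F x = 0) ∧ (∀ x ∈ W, x ∈ 𝓑.doc ↔ F x < 0) ∧ ∀ x ∈ W ∩ 𝓑.horizon, ∃ c : ℝ, c ≠ 0 ∧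 ∀ w : TangentSpace (𝓡 4) x, mfderiv (𝓡 4) 𝓘(ℝ, ℝ) F x w = c * 𝓑.metric.val x (K x) w) → ∀ (C : Set 𝓑.carrier), C ⊆ 𝓑.horizon → ∀ (N : ℕ) (δ : ℝ) (W : Fin N → Set 𝓑.carrier) (O : Fin N → Set E4) (χ : Fin N → 𝓑.carrier → E4) (χi : Fin N → E4 → 𝓑.carrier) (V : Fin N → Set ↥C) (f : Fin N → ↥C → EuclideanSpace ℝ (Fin 2)) (τ : ↥C → ℝ), 0 < δ → (∀ i, IsOpen (W i) ∧ IsOpen (O i) ∧ W i ⊆ U ∧ (∀ x ∈ W i, χ i x ∈ O i ∧ χi i (χ i x) = x) ∧ (∀ y ∈ O i, χi i y ∈ W i ∧ χ i (χi i y) = y) ∧ ContMDiffOn (𝓡 4) 𝓘(ℝ, E4) ∞ (χ i) (W i) ∧ ContMDiffOn 𝓘(ℝ, E4) (𝓡 4) ∞ (χi i) (O i) ∧ (∀ x ∈ W i, mfderiv (𝓡 4) 𝓘(ℝ, E4) (χ i) x (K x) = EuclideanSpace.single 0 1) ∧ (∀ x ∈ W i, x ∈ 𝓑.horizon ↔ χ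 i x 1 = 0) ∧ (∀ x ∈ W i, ∀ a b : ℝ, (∀ σ ∈ Ioo a b, χ i x + σ • EuclideanSpace.single 0 1 ∈ O i) → IsMIntegralCurveOn (fun σ : ℝ ↦ χi i (χ i x + σ • EuclideanSpace.single 0 1)) K (Ioo a b))) → (∀ i, ∀ x ∈ W i, |χ i x 0| < δ → ∀ s : ℝ, |s| < 2 * δ → (χ i x - (χ i x 0) • EuclideanSpace.single 0 1) + s • EuclideanSpace.single 0 1 ∈ O i) → (∀ i, IsOpen (V i)) → (∀ c : ↥C, ∃ i, c ∈ V i) → (∀ i, ∀ c ∈ V i, c.1 ∈ W i ∧ |χ i c.1 0| < δ / 2) → (∀ i, ∀ c ∈ V i, f i c 0 = χ i c.1 2 ∧ f i c 1 = χ i c.1 3) → ∀ [ChartedSpace (EuclideanSpace ℝ (Fin 2)) ↥C] [IsManifold (𝓡 2) ∞ ↥C], (∀ i, ContMDiffOn (𝓡 2) 𝓘(ℝ, EuclideanSpace ℝ (Fin 2)) ∞ (f i) (V i)) → (∀ i, ∀ c ∈ V i, Function.Injective (mfderiv (𝓡 2) 𝓘(ℝ, EuclideanSpace ℝ (Fin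 2)) (f i) c)) → (∀ c, |τ c| ≤ δ / 2) → (∀ i, ContMDiffOn (𝓡 2) 𝓘(ℝ, ℝ) ∞ (fun c : ↥C ↦ χ i c.1 0 + τ c) (V i)) → ∃ ι : ↥C → 𝓑.carrier, 𝓑.metric.toPseudoRiemannianMetric.IsSpacelikeImmersion (𝓡 2) ι ∧ Set.range ι ⊆ 𝓑.horizon := by
  intro 𝓑 _ U K hU hHU hK hKne hnull hdef C hCH N δ W O χ χi V f τ hδ hch hroom hVo hcov hV hf _ _ hfs hfinj hτ hh
  set e0 : E4 := EuclideanSpace.single 0 1 with he0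
  -- ## the transversal embedding `ι₀ : E2 → E4` and the coordinate functionals
  set ι0 : EuclideanSpace ℝ (Fin 2) →L[ℝ] E4 :=
    (EuclideanSpace.proj (0 : Fin 2)).smulRight (EuclideanSpace.single (2 : Fin 4) (1 : ℝ)) +
      (EuclideanSpace.proj (1 : Fin 2)).smulRight (EuclideanSpace.single (3 : Fin 4) (1 : ℝ)) with hι0
  have hι0_apply : ∀ w : EuclideanSpace ℝ (Fin 2), ι0 w =
      (w 0) • EuclideanSpace.single (2 : Fin 4) (1 : ℝ) + (w 1) • EuclideanSpace.single (3 : Fin 4) (1 : ℝ) :=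
    fun w ↦ rfl
  -- ## segments: for `c ∈ Vᵢ` the chart line stays in `Oᵢ` for parameters in `Ioo (-δ) δ`
  have hseg : ∀ i (c : ↥C), c ∈ V i → ∀ σ ∈ Ioo (-δ) δ, χ i c.1 + σ • e0 ∈ O i := by
    intro i c hc σ hσ
    obtain ⟨hx, hs⟩ := hV i c hc
    have h := hroom i c.1 hx (by linarith [hs]) (χ i c.1 0 + σ)
      (by rw [abs_lt] at hs ⊢; constructor <;> linarith [hσ.1, hσ.2, hs.1, hs.2])
    have : χ i c.1 - (χ i c.1 0) • e0 + (χ i c.1 0 + σ) • e0 = χ i c.1 + σ • e0 := by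
      rw [add_smul]; abel
    rwa [this] at h
  have hτmem : ∀ c : ↥C, τ c ∈ Ioo (-δ) δ := fun c ↦ by
    have h := hτ c; rw [abs_le] at h; constructor <;> linarith [h.1, h.2]
  -- ## chart independence of the section point
  have hindep : ∀ i k (c : ↥C), c ∈ V i → c ∈ V k →
      χi i (χ i c.1 + τ c • e0) = χi k (χ k c.1 + τ c • e0) := by
    intro i k c hci hck
    obtain ⟨_, _, hWiU, hinvi, hinvi', _, _, _, _, hlinei⟩ := hch i
    obtain ⟨_, _, hWkU, hinvk, hinvk', _, _, _, _, hlinek⟩ := hch k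
    exact sec_lineCoincide 𝓑 U K hU hK (W i) (W k) (O i) (O k) (χ i) (χ k) (χi i) (χi k) hWiU hWkU
      hinvi hinvk hinvi' hinvk' hlinei hlinek (hV i c hci).1 (hV k c hck).1 (by linarith) hδ
      (hseg i c hci) (hseg k c hck) (τ c) (hτmem c)
  -- ## the section
  have hidx : ∀ c : ↥C, ∃ i, c ∈ V i := hcov
  choose idx hidx' using hidx
  set ι : ↥C → 𝓑.carrier := fun c ↦ χi (idx c) (χ (idx c) c.1 + τ c • e0) with hιdef
  have hιi : ∀ i (c : ↥C), c ∈ V i → ι c = χi i (χ i c.1 + τ c • e0) := fun i c hc ↦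
    hindep (idx c) i c (hidx' c) hc
  -- ## the chart expression `Zᵢ = (χᵢ · 0 + τ) e₀ + ι₀ ∘ fᵢ`
  have hZ : ∀ i (c : ↥C), c ∈ V i → χ i c.1 + τ c • e0 = (χ i c.1 0 + τ c) • e0 + ι0 (f i c) := by
    intro i c hc
    obtain ⟨_, _, _, _, _, _, _, _, hhori, _⟩ := hch i
    have hx : c.1 ∈ W i := (hV i c hc).1
    have h1 : χ i c.1 1 = 0 := (hhori _ hx).1 (hCH c.2)
    obtain ⟨hf0, hf1⟩ := hf i c hc
    rw [hι0_apply]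
    ext k
    fin_cases k <;> simp [he0, h1, hf0, hf1]
  have hZmem : ∀ i (c : ↥C), c ∈ V i → χ i c.1 + τ c • e0 ∈ O i := fun i c hc ↦
    hseg i c hc (τ c) (hτmem c)
  have hZsmooth : ∀ i, ContMDiffOn (𝓡 2) 𝓘(ℝ, E4) ∞
      (fun c : ↥C ↦ (χ i c.1 0 + τ c) • e0 + ι0 (f i c)) (V i) := fun i ↦
    ((hh i).smul contMDiffOn_const).add (ι0.contMDiff.comp_contMDiffOn (hfs i))
  -- ## smoothness of `ι`
  have hιsmoothOn : ∀ i, ContMDiffOn (𝓡 2) (𝓡 4) ∞ ι (V i) := by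
    intro i
    obtain ⟨_, _, _, _, _, _, hχii, _, _, _⟩ := hch i
    have h1 : ContMDiffOn (𝓡 2) (𝓡 4) ∞
        (fun c : ↥C ↦ χi i ((χ i c.1 0 + τ c) • e0 + ι0 (f i c))) (V i) :=
      hχii.comp (hZsmooth i) (fun c hc ↦ by
        show ((χ i c.1 0 + τ c) • e0 + ι0 (f i c)) ∈ O i
        rw [← hZ i c hc]; exact hZmem i c hc)
    refine h1.congr (fun c hc ↦ ?_)
    rw [hιi i c hc, hZ i c hc]
  have hιsmooth : ContMDiff (𝓡 2) (𝓡 4) ∞ ι := fun c ↦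
    ((hιsmoothOn (idx c)).contMDiffAt ((hVo _).mem_nhds (hidx' c)))
  -- ## the image lies in the horizon
  have hιH : ∀ c : ↥C, ι c ∈ 𝓑.horizon := by
    intro c
    set i := idx c
    obtain ⟨_, _, _, _, hinvi', _, _, _, hhori, _⟩ := hch i
    have hc : c ∈ V i := hidx' c
    have hz := hZmem i c hc
    have hmem : ι c ∈ W i := (hinvi' _ hz).1
    refine (hhori _ hmem).2 ?_
    show χ i (χi i (χ i c.1 + τ c • e0)) 1 = 0
    rw [(hinvi' _ hz).2]
    have h1 : χ i c.1 1 = 0 := (hhori _ (hV i c hc).1).1 (hCH c.2)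
    simp [he0, h1]
  refine ⟨ι, ⟨?_, fun c v hv ↦ ?_⟩, by rintro _ ⟨c, rfl⟩; exact hιH c⟩
  · -- `C^{∞+1} = C^∞`
    exact hιsmooth.of_le (le_of_eq (by simp))
  · -- ## positivity of the induced form at `c` on `v ≠ 0`
    rw [PseudoRiemannianMetric.inducedBilin_apply]
    set i := idx c with hidef
    have hc : c ∈ V i := hidx' c
    obtain ⟨hWio, hOi, hWiU, hinvi, hinvi', hχsi, hχii, hstr, hhori, hlinei⟩ := hch i
    set z : E4 := χ i c.1 + τ c • e0 with hzdef
    have hz : z ∈ O i := hZmem i c hc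
    have hιc : ι c = χi i z := hιi i c hc
    have hpH : ι c ∈ 𝓑.horizon := hιH c
    have hpW : χi i z ∈ W i := (hinvi' z hz).1
    have hχz : χ i (χi i z) = z := (hinvi' z hz).2
    have hz1 : z 1 = 0 := by
      have h := (hhori _ hpW).1 (by rw [← hιc]; exact hpH)
      rwa [hχz] at h
    -- ### the differential of `ι` at `c`: `dι = D ∘ dZ`
    set D : E4 →L[ℝ] E4 := mfderiv 𝓘(ℝ, E4) (𝓡 4) (χi i) z with hDdef
    have hχid : MDifferentiableAt 𝓘(ℝ, E4) (𝓡 4) (χi i) z :=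
      (hχii.contMDiffAt (hOi.mem_nhds hz)).mdifferentiableAt (by simp)
    have hZd : MDifferentiableAt (𝓡 2) 𝓘(ℝ, E4) (fun c' : ↥C ↦ (χ i c'.1 0 + τ c') • e0 + ι0 (f i c')) c :=
      ((hZsmooth i).contMDiffAt ((hVo i).mem_nhds hc)).mdifferentiableAt (by simp)
    set ζ : E4 := mfderiv (𝓡 2) 𝓘(ℝ, E4) (fun c' : ↥C ↦ (χ i c'.1 0 + τ c') • e0 + ι0 (f i c')) c v
      with hζdef
    have hιeq : ι =ᶠ[𝓝 c] fun c' ↦ χi i ((χ i c'.1 0 + τ c') • e0 + ι0 (f i c')) := by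
      filter_upwards [(hVo i).mem_nhds hc] with c' hc'
      rw [hιi i c' hc', hZ i c' hc']
    have hzZ : (χ i c.1 0 + τ c) • e0 + ι0 (f i c) = z := (hZ i c hc).symm
    have hdι : mfderiv (𝓡 2) (𝓡 4) ι c v = D ζ := by
      rw [hιeq.mfderiv_eq]
      have hχid' : MDifferentiableAt 𝓘(ℝ, E4) (𝓡 4) (χi i) ((χ i c.1 0 + τ c) • e0 + ι0 (f i c)) := by
        rw [hzZ]; exact hχid
      have hcmp := (hχid'.hasMFDerivAt.comp c hZd.hasMFDerivAt).mfderiv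
      have happ : (mfderiv (𝓡 2) (𝓡 4) (fun c' : ↥C ↦ χi i ((χ i c'.1 0 + τ c') • e0 + ι0 (f i c'))) c :
          TangentSpace (𝓡 2) c →L[ℝ] E4) v =
          (mfderiv 𝓘(ℝ, E4) (𝓡 4) (χi i) ((χ i c.1 0 + τ c) • e0 + ι0 (f i c)) : E4 →L[ℝ] E4) ζ :=
        DFunLike.congr_fun hcmp v
      have key : ∀ w : E4, w = z →
          (mfderiv 𝓘(ℝ, E4) (𝓡 4) (χi i) w : E4 →L[ℝ] E4) ζ = D ζ := by
        rintro w rfl; rfl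
      exact happ.trans (key _ hzZ)
    -- ### the structure of `ζ`: `ζ = ζ₀ e₀ + ι₀ (dfᵢ v)`
    set u : EuclideanSpace ℝ (Fin 2) := mfderiv (𝓡 2) 𝓘(ℝ, EuclideanSpace ℝ (Fin 2)) (f i) c v with hudef
    have hfd : MDifferentiableAt (𝓡 2) 𝓘(ℝ, EuclideanSpace ℝ (Fin 2)) (f i) c :=
      ((hfs i).contMDiffAt ((hVo i).mem_nhds hc)).mdifferentiableAt (by simp)
    have hhd : MDifferentiableAt (𝓡 2) 𝓘(ℝ, ℝ) (fun c' : ↥C ↦ χ i c'.1 0 + τ c') c :=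
      ((hh i).contMDiffAt ((hVo i).mem_nhds hc)).mdifferentiableAt (by simp)
    -- coordinates of `ζ` through the coordinate functionals
    set Zf : ↥C → E4 := fun c' ↦ (χ i c'.1 0 + τ c') • e0 + ι0 (f i c') with hZfdef
    have hZd' : HasMFDerivAt (𝓡 2) 𝓘(ℝ, E4) Zf c (mfderiv (𝓡 2) 𝓘(ℝ, E4) Zf c) := hZd.hasMFDerivAt
    have hLζ : ∀ L : E4 →L[ℝ] ℝ, mfderiv (𝓡 2) 𝓘(ℝ, ℝ) (fun c' : ↥C ↦ L (Zf c')) c v = L ζ := by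
      intro L
      have h := (L.hasMFDerivAt.comp c hZd').mfderiv
      have h' : (mfderiv (𝓡 2) 𝓘(ℝ, ℝ) (⇑L ∘ Zf) c : TangentSpace (𝓡 2) c →L[ℝ] ℝ) v =
          L ((mfderiv (𝓡 2) 𝓘(ℝ, E4) Zf c : TangentSpace (𝓡 2) c →L[ℝ] E4) v) := DFunLike.congr_fun h v
      exact h'
    -- `ζ 1 = 0`
    have hζ1 : ζ 1 = 0 := by
      have hfun : (fun c' : ↥C ↦ (EuclideanSpace.proj (1 : Fin 4) : E4 →L[ℝ] ℝ) (Zf c')) = fun _ ↦ (0 : ℝ) := by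
        funext c'; simp [hZfdef, he0, hι0_apply]
      have hm : mfderiv (𝓡 2) 𝓘(ℝ, ℝ) (fun c' : ↥C ↦ (EuclideanSpace.proj (1 : Fin 4) : E4 →L[ℝ] ℝ) (Zf c')) c = 0 := by
        rw [hfun]; exact mfderiv_const
      have h := hLζ (EuclideanSpace.proj (1 : Fin 4))
      rw [hm] at h
      exact h.symm.trans rfl
    -- `ζ 2 = u 0`, `ζ 3 = u 1`
    have hζ23 : ∀ (k : Fin 4) (m : Fin 2), (∀ c' : ↥C, (Zf c') k = (f i c') m) → ζ k = u m := by
      intro k m hkm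
      have hfun : (fun c' : ↥C ↦ (EuclideanSpace.proj k : E4 →L[ℝ] ℝ) (Zf c')) =
          fun c' ↦ (EuclideanSpace.proj m : EuclideanSpace ℝ (Fin 2) →L[ℝ] ℝ) (f i c') := by
        funext c'; exact hkm c'
      have hm : mfderiv (𝓡 2) 𝓘(ℝ, ℝ) (fun c' : ↥C ↦ (EuclideanSpace.proj k : E4 →L[ℝ] ℝ) (Zf c')) c =
          mfderiv (𝓡 2) 𝓘(ℝ, ℝ) (fun c' : ↥C ↦ (EuclideanSpace.proj m : EuclideanSpace ℝ (Fin 2) →L[ℝ] ℝ) (f i c')) c := by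
        rw [hfun]
      have h := hLζ (EuclideanSpace.proj k)
      rw [hm] at h
      have h2 := ((EuclideanSpace.proj m : EuclideanSpace ℝ (Fin 2) →L[ℝ] ℝ).hasMFDerivAt.comp c
        hfd.hasMFDerivAt).mfderiv
      have h2' : (mfderiv (𝓡 2) 𝓘(ℝ, ℝ)
          (⇑(EuclideanSpace.proj m : EuclideanSpace ℝ (Fin 2) →L[ℝ] ℝ) ∘ f i) c : TangentSpace (𝓡 2) c →L[ℝ] ℝ) v =
          (EuclideanSpace.proj m : EuclideanSpace ℝ (Fin 2) →L[ℝ] ℝ) u := DFunLike.congr_fun h2 v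
      exact (h.symm.trans h2').trans rfl
    have hζ2 : ζ 2 = u 0 := hζ23 2 0 (fun c' ↦ by simp [hZfdef, he0, hι0_apply])
    have hζ3 : ζ 3 = u 1 := hζ23 3 1 (fun c' ↦ by simp [hZfdef, he0, hι0_apply])
    have hζeq : ζ = (ζ 0) • e0 + ι0 u := by
      rw [hι0_apply]
      ext k
      fin_cases k <;> simp [he0, hζ1, hζ2, hζ3]
    -- ### `dι v = ζ₀ K + ξ` with `ξ ⊥ K`
    set ξ : E4 := D (ι0 u) with hξdef
    set Kz : E4 := K (χi i z) with hKzdef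
    have hDe0 : D e0 = Kz :=
      sec_mfderiv_chartInverse_e0 𝓑 K (W i) (O i) (χ i) (χi i) hOi hinvi' hχii hlinei hz
    have hDζ : D ζ = (ζ 0) • Kz + ξ := by
      conv_lhs => rw [hζeq]
      rw [map_add, map_smul, hDe0]
    have hHz : χi i z ∈ 𝓑.horizon := by rw [← hιc]; exact hpH
    obtain ⟨W', hW'o, hpW', -, F, hF, hFH, -, hFc⟩ := hdef (χi i z) hHz
    obtain ⟨c', hc', hdF⟩ := hFc (χi i z) ⟨hpW', hHz⟩
    have hu1 : (ι0 u) 1 = 0 := by simp [hι0_apply]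
    have hKξ : 𝓑.metric.val (χi i z) Kz ξ = 0 :=
      sec_orthogonal_of_horizonCurve 𝓑 K (W i) (O i) (χ i) (χi i) hOi hinvi' hχii hhori hz hz1 hu1
        hW'o hpW' hF hFH hc' hdF
    obtain ⟨hexp, hnn, hzero⟩ := sec_pos_of_transverse 𝓑 (χi i z) Kz ξ (ζ 0)
      (hnull _ hHz) (hKne _ hHz) hKξ
    -- ### conclusion
    rw [hdι]
    have hgoal : 0 < 𝓑.metric.val (χi i z) (D ζ) (D ζ) := by
      rw [hDζ, hexp]
      rcases hnn.lt_or_eq with hlt | heq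
      · exact hlt
      · exfalso
        obtain ⟨lam, hlam⟩ := hzero heq.symm
        -- read back through `dχᵢ`: `ι₀ u = λ e₀`
        set E : E4 →L[ℝ] E4 := mfderiv (𝓡 4) 𝓘(ℝ, E4) (χ i) (χi i z) with hEdef
        have hχd : MDifferentiableAt (𝓡 4) 𝓘(ℝ, E4) (χ i) (χi i z) :=
          (hχsi.contMDiffAt (hWio.mem_nhds hpW)).mdifferentiableAt (by simp)
        have hED : ∀ w : E4, E (D w) = w := by
          intro w
          have hcomp := (hχd.hasMFDerivAt.comp z hχid.hasMFDerivAt).mfderiv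
          have hid : (χ i ∘ χi i) =ᶠ[𝓝 z] id := by
            filter_upwards [hOi.mem_nhds hz] with y hy
            exact (hinvi' y hy).2
          rw [hid.mfderiv_eq, mfderiv_id] at hcomp
          have happ : (ContinuousLinearMap.id ℝ (TangentSpace 𝓘(ℝ, E4) z)) w = (E.comp D) w :=
            DFunLike.congr_fun hcomp w
          exact happ.symm
        have hEK : E Kz = e0 := hstr _ hpW
        have hι0u : ι0 u = lam • e0 := by
          have h := hED (ι0 u)
          rw [show D (ι0 u) = ξ from rfl, hlam, map_smul, hEK] at h
          exact h.symm
        have hu0 : u = 0 := by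
          have h2 : (ι0 u) 2 = (lam • e0) 2 := by rw [hι0u]
          have h3 : (ι0 u) 3 = (lam • e0) 3 := by rw [hι0u]
          simp [hι0_apply, he0] at h2 h3
          ext m
          fin_cases m <;> simp [h2, h3]
        apply hv
        apply hfinj i c hc
        rw [map_zero]
        exact hu0
    -- transport from `χi i z` to `ι c`
    have key : ∀ q : 𝓑.carrier, q = ι c → 0 < 𝓑.metric.val q (D ζ) (D ζ) →
        0 < 𝓑.metric.val (ι c) (D ζ) (D ζ) := by
      rintro q rfl h; exact h
    exact key _ hιc.symm hgoal

end Summit.FinalStateConjecture.FinalStateConjecture.Theorems.HawkingExtensionIsKerr.SketchIdeator2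

end
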